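import Literature.AlgebraicGeometry.Motives.ComplexPointsSubmersion
import Literature.AlgebraicGeometry.Motives.AlgPointsProperMapProofs
import Literature.AlgebraicTopology.Homotopy.FibreBundlesProofs
import HarnessLib

/-!
# Ehresmann's theorem on the complex points of a smooth proper morphism (proofs)

Topic `Literature/AlgebraicGeometry/Motives`. For a morphism `f : X ⟶ Y` of `ℂ`-schemes the tree
has: the complex points `X(ℂ)` with the strong topology (`Motives/AlgPoints`), the real charted
space `ComplexPoints.chartedSpace X n` on `X(ℂ)` modelled on `ℝ²ⁿ` for `X` smooth over `ℂ` (holomorphic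
algebraic charts, Serre GAGA §2 n°5 Prop. 2; `Motives/ComplexPointsManifold`) which is a real `C^∞`
manifold on which `f(ℂ)` is `C^∞` and, for `f` smooth, a submersion
(`Motives/ComplexPointsSubmersion`: `isManifold_real`, `contMDiff_map`, `surjective_mfderiv_map`;
SGA1 XII Prop. 3.1 (iv)), the properness of `f(ℂ)` for `f` proper (`AlgPoints.isProperMap_map`,
SGA1 XII Prop. 3.2 (v)), and Ehresmann's fibration theorem for proper submersions of real `C^∞`
manifolds (`AlgebraicTopology.Homotopy.ehresmann_fibration_holds`, Bröcker–Jänich (8.12)). This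
file puts them together (everything PROVED, no named facts):

* `ComplexPoints.isLocallyTrivialFibration_map` — **Ehresmann on complex points**: for `f` smooth
  and proper between separated `ℂ`-schemes smooth over `ℂ` with second countable complex points,
  `f(ℂ)` is a locally trivial fibration (`U × f(ℂ)⁻¹(t) ≃ f(ℂ)⁻¹(U)` over a neighbourhood `U` of
  each `t`) — Voisin I Thm. 9.3 ("a proper holomorphic submersion is locally trivial") on the
  tree's carriers, with homeomorphic trivialisations; variants `exists_trivialisation_map`,
  `isLocallyTrivialFibration_map_of_smoothOfRelativeDimension` (hypotheses on `f` rather than `X`);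
* `IsLocallyTrivialFibration.exists_trivialisation_of_isOpenEmbedding` — point-set transport of
  local trivialisations along open embeddings of total space and base;
* `exists_trivialisation_of_smoothOfRelativeDimension_morphismRestrict` — **Ehresmann over an open
  `V₀` of the base where the proper family `π : 𝒳 ⟶ S` is smooth**: `π(ℂ)` is topologically
  locally trivial over `V₀(ℂ)` (the restricted family `π⁻¹V₀ ⟶ V₀` as `ℂ`-schemes,
  `restrictOverHom`, and the open embeddings `π⁻¹V₀(ℂ) ↪ 𝒳(ℂ)`, `V₀(ℂ) ↪ S(ℂ)` of
  `AlgPoints.isOpenEmbedding_map_holds`). This is the input of the local systems `Rᵏ π_* A` over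
  the smooth locus (Voisin I §9.2.1; for the universal hyperplane section over `U`, Voisin II
  §3.2.2 and `HodgeTheory/HyperplaneSectionMonodromyTrivialisations`).

## References

* [VoisinHodgeI2002] C. Voisin, Hodge Theory and Complex Algebraic Geometry I, CUP 2002, Thm. 9.3,
  Prop. 9.5, §9.2.1.
* [BrockerJanichIDT1982] Th. Bröcker, K. Jänich, Introduction to Differential Topology, CUP 1982,
  (8.12) (Fibration theorem of Ehresmann).
* [SerreGAGA1956] J.-P. Serre, Géométrie algébrique et géométrie analytique, Ann. Inst. Fourier 6
  (1956), §2 n°5 Prop. 2 and p. 9, n°6.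
* [SGA1] A. Grothendieck, M. Raynaud, SGA 1, Exp. XII, Prop. 3.1 (iv), Prop. 3.2 (v).
-/

noncomputable section

open CategoryTheory AlgebraicGeometry Filter
open scoped Manifold ContDiff Topology
open Literature.AlgebraicGeometry.Motives.AlgPoints (evalOrZero evalOrZero_of_mem evalOrZero_of_not_mem)

namespace Literature.AlgebraicGeometry.Motives

namespace ComplexPoints

/-! ### Ehresmann's theorem for `f(ℂ)` -/

section Ehresmann

open Literature.AlgebraicTopology.Homotopy

variable {X Y : SchemeOver ℂ} [LocallyOfFiniteType X.hom] [LocallyOfFiniteType Y.hom]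

/-- **Ehresmann's theorem on complex points.** Let `f : X ⟶ Y` be a smooth and proper morphism of
separated `ℂ`-schemes, with `X` and `Y` smooth over `ℂ` (of relative dimensions `n`, `m`) and
`X(ℂ)`, `Y(ℂ)` second countable (e.g. `X`, `Y` of finite type). Then
`f(ℂ) : X(ℂ) → Y(ℂ)` is a locally trivial fibration: every `t ∈ Y(ℂ)` has an open neighbourhood
`U` with `U × f(ℂ)⁻¹(t) ≃ f(ℂ)⁻¹(U)` over `U`. Indeed `f(ℂ)` is a proper (`AlgPoints.isProperMap_map`,
SGA1 XII Prop. 3.2 (v)) submersion (`surjective_mfderiv_map`, SGA1 XII Prop. 3.1 (iv)) of the real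
`C^∞` manifolds `X(ℂ)`, `Y(ℂ)` (`isManifold_real`, Serre GAGA §2), so the tree's PROVED
fibration theorem of Ehresmann (`ehresmann_fibration_holds`, Bröcker–Jänich (8.12)) applies. This is
the theorem invoked in Voisin I, Thm. 9.3 / §9.1.1 for families of compact complex manifolds
("a proper holomorphic submersion is locally differentiably trivial").
[cite: VoisinHodgeI2002, Thm. 9.3 (Ehresmann) with Prop. 9.5]
[cite: BrockerJanichIDT1982, (8.12) (Fibration theorem of Ehresmann)]
[cite: SGA1, Exp. XII Prop. 3.1 (iv) and Prop. 3.2 (v)] -/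
theorem isLocallyTrivialFibration_map (n m : ℕ) [SmoothOfRelativeDimension n X.hom]
    [SmoothOfRelativeDimension m Y.hom] (f : X ⟶ Y) [Smooth f.left] [IsProper f.left]
    [IsSeparated X.hom] [IsSeparated Y.hom]
    [SecondCountableTopology (ComplexPoints X)] [SecondCountableTopology (ComplexPoints Y)] :
    IsLocallyTrivialFibration (AlgPoints.map f : ComplexPoints X → ComplexPoints Y) := by
  letI := ComplexPoints.chartedSpace X n
  letI := ComplexPoints.chartedSpace Y m
  haveI := isManifold_real X n
  haveI := isManifold_real Y m
  haveI : T2Space (ComplexPoints X) := ComplexPoints.t2Space_of_isSeparated X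
  haveI : T2Space (ComplexPoints Y) := ComplexPoints.t2Space_of_isSeparated Y
  exact ehresmann_fibration_holds (2 * n) (2 * m) (ComplexPoints X) (ComplexPoints Y)
    (AlgPoints.map f) (contMDiff_map f) (AlgPoints.isProperMap_map f) (surjective_mfderiv_map f)

/-- **Local topological triviality of `f(ℂ)`** (Ehresmann, as used in Voisin I §9.1.1–9.2.1): in
the situation of `isLocallyTrivialFibration_map`, every `t ∈ Y(ℂ)` has an open neighbourhood `V`
and a homeomorphism `V × F ≃ f(ℂ)⁻¹(V)` commuting with the projections to `V` (`F` the fibre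
over `t`). [cite: VoisinHodgeI2002, Thm. 9.3] [cite: BrockerJanichIDT1982, (8.12)] -/
theorem exists_trivialisation_map (n m : ℕ) [SmoothOfRelativeDimension n X.hom]
    [SmoothOfRelativeDimension m Y.hom] (f : X ⟶ Y) [Smooth f.left] [IsProper f.left]
    [IsSeparated X.hom] [IsSeparated Y.hom]
    [SecondCountableTopology (ComplexPoints X)] [SecondCountableTopology (ComplexPoints Y)]
    (t : ComplexPoints Y) :
    ∃ V : Set (ComplexPoints Y), IsOpen V ∧ t ∈ V ∧
      ∃ (F : Type) (_ : TopologicalSpace F)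
        (φ : V × F ≃ₜ ((AlgPoints.map f : ComplexPoints X → ComplexPoints Y) ⁻¹' V)),
        ∀ x, AlgPoints.map f (φ x : ComplexPoints X) = (x.1 : ComplexPoints Y) := by
  obtain ⟨V, hVo, htV, φ, hφ⟩ := isLocallyTrivialFibration_map n m f t
  exact ⟨V, hVo, htV, _, inferInstance, φ, hφ⟩

omit [LocallyOfFiniteType X.hom] [LocallyOfFiniteType Y.hom] in
/-- The source of a morphism smooth of relative dimension `d` into a `ℂ`-scheme smooth of relative
dimension `m` is smooth over `ℂ` of relative dimension `d + m` (composition). [folklore] -/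
theorem smoothOfRelativeDimension_hom_of_hom (f : X ⟶ Y) (d m : ℕ) [SmoothOfRelativeDimension d f.left]
    [SmoothOfRelativeDimension m Y.hom] : SmoothOfRelativeDimension (d + m) X.hom := by
  rw [← Over.w f]
  infer_instance

omit [LocallyOfFiniteType X.hom] in
/-- The source of a morphism locally of finite type into a `ℂ`-scheme locally of finite type is
locally of finite type over `ℂ`. [folklore] -/
theorem locallyOfFiniteType_hom_of_hom (f : X ⟶ Y) [LocallyOfFiniteType f.left] :
    LocallyOfFiniteType X.hom := by
  rw [← Over.w f]
  infer_instance

omit [LocallyOfFiniteType X.hom] in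
/-- **Ehresmann for a smooth proper family over a smooth base** (the form of Voisin I Thm. 9.3 for
`φ : 𝒳 → B`): if `f : X ⟶ Y` is proper and smooth of relative dimension `d`, `Y` is smooth over
`ℂ` of relative dimension `m`, both are separated with second countable complex points, then `f(ℂ)`
is a locally trivial fibration. [cite: VoisinHodgeI2002, Thm. 9.3] [cite: BrockerJanichIDT1982, (8.12)] -/
theorem isLocallyTrivialFibration_map_of_smoothOfRelativeDimension (d m : ℕ)
    [SmoothOfRelativeDimension m Y.hom] (f : X ⟶ Y) [SmoothOfRelativeDimension d f.left]
    [IsProper f.left] [IsSeparated X.hom] [IsSeparated Y.hom]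
    [SecondCountableTopology (ComplexPoints X)] [SecondCountableTopology (ComplexPoints Y)] :
    IsLocallyTrivialFibration (AlgPoints.map f : ComplexPoints X → ComplexPoints Y) := by
  haveI := smoothOfRelativeDimension_hom_of_hom f d m
  haveI : LocallyOfFiniteType f.left := inferInstance
  haveI := locallyOfFiniteType_hom_of_hom f
  haveI : Smooth f.left := SmoothOfRelativeDimension.smooth d f.left
  exact isLocallyTrivialFibration_map (d + m) m f

end Ehresmann

end ComplexPoints

/-! ### Transport of local trivialisations along open embeddings; restriction over an open of the base -/

section Transport

open Literature.AlgebraicTopology.Homotopy Topology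

/-- **Local trivialisations pass along open embeddings.** Let `p : E → B` be continuous and
`p' : E' → B'` a locally trivial fibration, embedded in `p` by open embeddings `i : E' → E`,
`j : B' → B` with `p ∘ i = j ∘ p'` and `p⁻¹(j(B')) ⊆ i(E')` (so that `p'` is `p` restricted over
the open `j(B') ⊆ B`). Then over a neighbourhood `V ⊆ j(B')` of each point `j b'`, `p` is trivial:
`V × p'⁻¹(b') ≃ p⁻¹(V)` over `V`. (Point-set bookkeeping.) [folklore] -/
theorem _root_.Literature.AlgebraicTopology.Homotopy.IsLocallyTrivialFibration.exists_trivialisation_of_isOpenEmbedding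
    {E B E' B' : Type*} [TopologicalSpace E] [TopologicalSpace B] [TopologicalSpace E']
    [TopologicalSpace B'] {p : E → B} {p' : E' → B'} {i : E' → E} {j : B' → B}
    (htriv : IsLocallyTrivialFibration p') (hi : IsOpenEmbedding i) (hj : IsOpenEmbedding j)
    (hp : Continuous p) (hcomm : ∀ e', p (i e') = j (p' e'))
    (hrange : p ⁻¹' Set.range j ⊆ Set.range i) (b' : B') :
    ∃ V : Set B, IsOpen V ∧ j b' ∈ V ∧ V ⊆ Set.range j ∧
      ∃ φ : V × (p' ⁻¹' {b'}) ≃ₜ (p ⁻¹' V), ∀ x, p (φ x) = x.1 := by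
  obtain ⟨U', hU'o, hbU', φ', hφ'⟩ := htriv b'
  set V : Set B := j '' U' with hV
  have hVo : IsOpen V := hj.isOpenMap _ hU'o
  have hVr : V ⊆ Set.range j := Set.image_subset_range _ _
  -- the inverse of `j` on `V`
  let jH := hj.isEmbedding.toHomeomorph
  have hjH : ∀ b, (jH b : B) = j b := fun _ ↦ rfl
  let jinv : V → B' := fun v ↦ jH.symm ⟨v, hVr v.2⟩
  have hjinv : ∀ v : V, j (jinv v) = v := fun v ↦ by
    rw [← hjH, Homeomorph.apply_symm_apply]
  have hjinv_mem : ∀ v : V, jinv v ∈ U' := fun v ↦ by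
    obtain ⟨u, hu, huv⟩ := v.2
    have h : jinv v = u := hj.injective (by rw [hjinv, huv])
    rw [h]
    exact hu
  have hjinv_cont : Continuous jinv := jH.symm.continuous.comp (continuous_inclusion hVr)
  -- the inverse of `i` on `p⁻¹ V`
  let iH := hi.isEmbedding.toHomeomorph
  have hiH : ∀ e', (iH e' : E) = i e' := fun _ ↦ rfl
  have hmemi : ∀ e : p ⁻¹' V, (e : E) ∈ Set.range i := fun e ↦
    hrange (show p e ∈ Set.range j from hVr e.2)
  let iinv : p ⁻¹' V → E' := fun e ↦ iH.symm ⟨e, hmemi e⟩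
  have hiinv : ∀ e, i (iinv e) = e := fun e ↦ by
    rw [← hiH, Homeomorph.apply_symm_apply]
  have hiinv_cont : Continuous iinv :=
    iH.symm.continuous.comp (continuous_subtype_val.subtype_mk fun e ↦ hmemi e)
  have hiinv_mem : ∀ e : p ⁻¹' V, p' (iinv e) ∈ U' := fun e ↦ by
    obtain ⟨u, hu, hue⟩ := (e.2 : p e ∈ V)
    have h1 : j (p' (iinv e)) = j u := by rw [← hcomm, hiinv, hue]
    rw [hj.injective h1]
    exact hu
  -- the trivialisation of `p` over `V`
  have hΦ : ∀ x : V × (p' ⁻¹' {b'}),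
      p (i (φ' (⟨jinv x.1, hjinv_mem x.1⟩, x.2))) = x.1 := fun x ↦ by
    rw [hcomm, hφ']
    exact hjinv x.1
  let Φ : V × (p' ⁻¹' {b'}) → p ⁻¹' V := fun x ↦
    ⟨i (φ' (⟨jinv x.1, hjinv_mem x.1⟩, x.2)), by rw [Set.mem_preimage, hΦ]; exact x.1.2⟩
  let Ψ : p ⁻¹' V → V × (p' ⁻¹' {b'}) := fun e ↦
    (⟨p e, e.2⟩, (φ'.symm ⟨iinv e, hiinv_mem e⟩).2)
  have hleft : ∀ x, Ψ (Φ x) = x := fun x ↦ by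
    have h1 : iinv (Φ x) = φ' (⟨jinv x.1, hjinv_mem x.1⟩, x.2) := hi.injective (by rw [hiinv])
    refine Prod.ext (Subtype.ext (hΦ x)) ?_
    change (φ'.symm ⟨iinv (Φ x), hiinv_mem (Φ x)⟩).2 = x.2
    have h2 : (⟨iinv (Φ x), hiinv_mem (Φ x)⟩ : p' ⁻¹' U') =
        φ' (⟨jinv x.1, hjinv_mem x.1⟩, x.2) := Subtype.ext h1
    rw [h2, Homeomorph.symm_apply_apply]
  have hright : ∀ e, Φ (Ψ e) = e := fun e ↦ by
    set y : p' ⁻¹' U' := ⟨iinv e, hiinv_mem e⟩ with hy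
    have h1 : (φ'.symm y).1 = ⟨jinv ⟨p e, e.2⟩, hjinv_mem ⟨p e, e.2⟩⟩ := by
      refine Subtype.ext (hj.injective ?_)
      rw [← hφ' (φ'.symm y), Homeomorph.apply_symm_apply, hjinv, ← hcomm, hiinv]
    refine Subtype.ext ?_
    change i (φ' (⟨jinv ⟨p e, e.2⟩, hjinv_mem ⟨p e, e.2⟩⟩, (φ'.symm y).2)) = e
    rw [← h1, Prod.mk.eta, Homeomorph.apply_symm_apply]
    exact hiinv e
  refine ⟨V, hVo, ⟨b', hbU', rfl⟩, hVr,
    { toFun := Φ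
      invFun := Ψ
      left_inv := hleft
      right_inv := hright
      continuous_toFun := ?_
      continuous_invFun := ?_ }, fun x ↦ hΦ x⟩
  · exact (hi.continuous.comp (continuous_subtype_val.comp (φ'.continuous.comp
      ((hjinv_cont.comp continuous_fst).subtype_mk _ |>.prodMk continuous_snd)))).subtype_mk _
  · exact ((hp.comp continuous_subtype_val).subtype_mk _).prodMk
      (continuous_snd.comp (φ'.symm.continuous.comp (hiinv_cont.subtype_mk _)))

end Transport

section Restrict

open Literature.AlgebraicTopology.Homotopy Topology

variable {𝒳 S : SchemeOver ℂ}

/-- An open subscheme `O ⊆ X` of a `ℂ`-scheme as a `ℂ`-scheme, structure map `O ↪ X → Spec ℂ`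
(the same construction as `openSubschemeOver` of `Motives/OpenImmersionGraph`, repeated here to
keep the imports of this file light). [folklore] -/
def openSubschemeOver (X : SchemeOver ℂ) (O : X.left.Opens) : SchemeOver ℂ := Over.mk (O.ι ≫ X.hom)

/-- The open immersion `O ↪ X` over `ℂ`. [folklore] -/
def openSubschemeOverι (X : SchemeOver ℂ) (O : X.left.Opens) : openSubschemeOver X O ⟶ X :=
  Over.homMk O.ι rfl

/-- The underlying morphism of `openSubschemeOverι` is `O.ι` (`rfl`). [folklore] -/
@[simp]
theorem openSubschemeOverι_left (X : SchemeOver ℂ) (O : X.left.Opens) :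
    (openSubschemeOverι X O).left = O.ι := rfl

/-- The structure map of `openSubschemeOver X O` is `O.ι ≫ X.hom` (`rfl`). [folklore] -/
@[simp]
theorem openSubschemeOver_hom (X : SchemeOver ℂ) (O : X.left.Opens) :
    (openSubschemeOver X O).hom = O.ι ≫ X.hom := rfl

variable (π : 𝒳 ⟶ S) (V₀ : S.left.Opens)

/-- The restriction `π|_{V₀} : π⁻¹V₀ ⟶ V₀` of a family `π : 𝒳 ⟶ S` over an open `V₀ ⊆ S`, as a
morphism of `ℂ`-schemes between the open subschemes `π⁻¹V₀ ⊆ 𝒳` and `V₀ ⊆ S` (Mathlib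
`morphismRestrict`). [folklore] -/
def restrictOverHom : openSubschemeOver 𝒳 (π.left ⁻¹ᵁ V₀) ⟶ openSubschemeOver S V₀ :=
  Over.homMk (π.left ∣_ V₀) (by
    change (π.left ∣_ V₀) ≫ V₀.ι ≫ S.hom = (π.left ⁻¹ᵁ V₀).ι ≫ 𝒳.hom
    rw [← Category.assoc, morphismRestrict_ι, Category.assoc, Over.w π])

/-- The underlying scheme morphism of `restrictOverHom π V₀` is `π ∣_ V₀` (`rfl`). [folklore] -/
@[simp]
theorem restrictOverHom_left : (restrictOverHom π V₀).left = π.left ∣_ V₀ := rfl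

/-- The restriction square commutes: `π|_{V₀} ≫ (V₀ ↪ S) = (π⁻¹V₀ ↪ 𝒳) ≫ π`. [folklore] -/
theorem restrictOverHom_comp_openSubschemeOverι :
    restrictOverHom π V₀ ≫ openSubschemeOverι S V₀ =
      openSubschemeOverι 𝒳 (π.left ⁻¹ᵁ V₀) ≫ π := by
  ext1
  exact morphismRestrict_ι π.left V₀

/-- **Ehresmann over an open of the base where the family is smooth.** Let `π : 𝒳 ⟶ S` be a proper
morphism of separated `ℂ`-schemes with second countable complex points, `S` smooth over `ℂ` of
relative dimension `m`, and let `V₀ ⊆ S` be an open over which `π` is smooth of relative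
dimension `d`. Then `π(ℂ)` is topologically locally trivial over `V₀(ℂ)`: every `t ∈ V₀(ℂ)` has an
open neighbourhood `V ⊆ V₀(ℂ)` in `S(ℂ)` with `V × F ≃ π(ℂ)⁻¹(V)` over `V` — Ehresmann's theorem
(`ComplexPoints.isLocallyTrivialFibration_map_of_smoothOfRelativeDimension`) for the smooth proper
family `π⁻¹V₀ ⟶ V₀`, transported along the open embeddings `π⁻¹V₀(ℂ) ↪ 𝒳(ℂ)`, `V₀(ℂ) ↪ S(ℂ)`
(`AlgPoints.isOpenEmbedding_map_holds`). This is the statement used for the local systems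
`Rᵏ π_* A` over the smooth locus (Voisin I §9.2.1; Voisin II §3.2.2 for the universal hyperplane
section over `U`). [cite: VoisinHodgeI2002, Thm. 9.3 and §9.2.1] [cite: BrockerJanichIDT1982, (8.12)] -/
theorem exists_trivialisation_of_smoothOfRelativeDimension_morphismRestrict (d m : ℕ)
    [SmoothOfRelativeDimension m S.hom] [IsSeparated S.hom] [IsSeparated 𝒳.hom] [IsProper π.left]
    [SecondCountableTopology (ComplexPoints 𝒳)] [SecondCountableTopology (ComplexPoints S)]
    [SmoothOfRelativeDimension d (π.left ∣_ V₀)] (t : ComplexPoints S) (ht : t.pt ∈ V₀) :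
    ∃ V : Set (ComplexPoints S), IsOpen V ∧ t ∈ V ∧ V ⊆ {s | s.pt ∈ V₀} ∧
      ∃ (F : Type) (_ : TopologicalSpace F)
        (φ : V × F ≃ₜ ((AlgPoints.map π : ComplexPoints 𝒳 → ComplexPoints S) ⁻¹' V)),
        ∀ x, AlgPoints.map π (φ x : ComplexPoints 𝒳) = (x.1 : ComplexPoints S) := by
  set 𝒳V := openSubschemeOver 𝒳 (π.left ⁻¹ᵁ V₀) with h𝒳V
  set SV := openSubschemeOver S V₀ with hSV
  set πV := restrictOverHom π V₀ with hπV
  set iX := openSubschemeOverι 𝒳 (π.left ⁻¹ᵁ V₀) with hiX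
  set iS := openSubschemeOverι S V₀ with hiS
  -- instances on the restricted family
  haveI : Smooth S.hom := SmoothOfRelativeDimension.smooth m _
  haveI : LocallyOfFiniteType S.hom := inferInstance
  haveI : LocallyOfFiniteType 𝒳.hom := by rw [← Over.w π]; infer_instance
  haveI : IsOpenImmersion iX.left := inferInstanceAs (IsOpenImmersion (π.left ⁻¹ᵁ V₀).ι)
  haveI : IsOpenImmersion iS.left := inferInstanceAs (IsOpenImmersion V₀.ι)
  haveI : LocallyOfFiniteType SV.hom := inferInstanceAs (LocallyOfFiniteType (V₀.ι ≫ S.hom))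
  haveI : SmoothOfRelativeDimension m SV.hom := by
    have h : SmoothOfRelativeDimension (0 + m) (V₀.ι ≫ S.hom) := inferInstance
    rw [Nat.zero_add] at h
    exact h
  haveI : IsSeparated SV.hom := inferInstanceAs (IsSeparated (V₀.ι ≫ S.hom))
  haveI : IsSeparated 𝒳V.hom := inferInstanceAs (IsSeparated ((π.left ⁻¹ᵁ V₀).ι ≫ 𝒳.hom))
  haveI : IsProper πV.left := inferInstanceAs (IsProper (π.left ∣_ V₀))
  haveI : SmoothOfRelativeDimension d πV.left := inferInstanceAs (SmoothOfRelativeDimension d (π.left ∣_ V₀))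
  have hiXe : IsOpenEmbedding (AlgPoints.map iX : ComplexPoints 𝒳V → ComplexPoints 𝒳) :=
    AlgPoints.isOpenEmbedding_map_holds iX
  have hiSe : IsOpenEmbedding (AlgPoints.map iS : ComplexPoints SV → ComplexPoints S) :=
    AlgPoints.isOpenEmbedding_map_holds iS
  haveI : SecondCountableTopology (ComplexPoints 𝒳V) := hiXe.isEmbedding.secondCountableTopology
  haveI : SecondCountableTopology (ComplexPoints SV) := hiSe.isEmbedding.secondCountableTopology
  have htriv := ComplexPoints.isLocallyTrivialFibration_map_of_smoothOfRelativeDimension d m πV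
  -- ranges of the open embeddings
  have hrS : Set.range (AlgPoints.map iS : ComplexPoints SV → ComplexPoints S) = {s | s.pt ∈ V₀} := by
    rw [AlgPoints.range_map_of_isOpenImmersion_holds iS]
    ext Q
    change Q.pt ∈ V₀.ι.opensRange ↔ Q.pt ∈ V₀
    rw [Scheme.Opens.opensRange_ι]
  have hrX : Set.range (AlgPoints.map iX : ComplexPoints 𝒳V → ComplexPoints 𝒳) =
      {P | P.pt ∈ π.left ⁻¹ᵁ V₀} := by
    rw [AlgPoints.range_map_of_isOpenImmersion_holds iX]
    ext Q
    change Q.pt ∈ (π.left ⁻¹ᵁ V₀).ι.opensRange ↔ Q.pt ∈ π.left ⁻¹ᵁ V₀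
    rw [Scheme.Opens.opensRange_ι]
  obtain ⟨t', rfl⟩ : t ∈ Set.range (AlgPoints.map iS : ComplexPoints SV → ComplexPoints S) := by
    rw [hrS]; exact ht
  have hcomm : ∀ e' : ComplexPoints 𝒳V,
      AlgPoints.map π (AlgPoints.map iX e') = AlgPoints.map iS (AlgPoints.map πV e') := fun e' ↦ by
    have h := congrArg (fun ψ ↦ (AlgPoints.map ψ e' : ComplexPoints S))
      (restrictOverHom_comp_openSubschemeOverι π V₀)
    simp only [AlgPoints.map_comp_apply] at h
    exact h.symm
  have hrange : (AlgPoints.map π : ComplexPoints 𝒳 → ComplexPoints S) ⁻¹'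
      Set.range (AlgPoints.map iS : ComplexPoints SV → ComplexPoints S) ⊆
        Set.range (AlgPoints.map iX : ComplexPoints 𝒳V → ComplexPoints 𝒳) := by
    rw [hrS, hrX]
    intro P hP
    exact hP
  obtain ⟨V, hVo, htV, hVr, φ, hφ⟩ := htriv.exists_trivialisation_of_isOpenEmbedding hiXe hiSe
    (AlgPoints.continuous_map π) hcomm hrange t'
  refine ⟨V, hVo, htV, ?_, _, inferInstance, φ, hφ⟩
  rw [← hrS]
  exact hVr

end Restrict

end Literature.AlgebraicGeometry.Motives

end
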